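import Summits.QuantumFields.QCD.Theses.HeatSlicedQuarks
import Literature.MathematicalPhysics.QuantumFieldTheory.QCDTransferMatrix
import Literature.Analysis.OperatorTheory.HermitianKernelSpectralTrace

/-!
# Stub `stub_gradedCyclicTrace` of line `pin-the-infimum` (crux `RobustYangMillsHandover`, item 8892)

The abstract complex GRADED TRACE-OF-POWERS formula (M1(b) of the Lüscher dictionary infrastructure): for a
bounded Hermitian kernel `K` on a finite measure space, its `L²` integral operator `A` (compact self-adjoint), a
countable Hilbert basis of eigenvectors `A bᵢ = λᵢ bᵢ` with real eigenvalues and a bounded measurable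
multiplication insertion `θ`,
`Σᵢ λᵢ^{M+2} ⟨bᵢ, θ bᵢ⟩ = ∫ θ(V 0) K(V 0, V 1) ⋯ K(V (M+1), V 0) dμ^{⊗(M+2)}(V)`  ("`Tr(Θ A^{M+2})`" as a
periodic path integral, without trace-class theory).  It is the `𝕜 = ℂ` instance of
`Literature.Analysis.OperatorTheory.hasSum_pow_integral_cyclic_obs_rclike`
(`Literature/Analysis/OperatorTheory/HermitianKernelSpectralTrace.lean`, with the complex cyclic peeling of
`ComplexKernelCyclicPeeling.lean`); the slice transfer kernel of the time-periodic QCD torus functional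
(`HeatSlicedQuarksRobustYangMillsHandoverTransferKernelRegular.lean`) with `θ` = fermion parity is the intended
instance.
-/

open MeasureTheory Filter Function Matrix
open Literature.MathematicalPhysics.QuantumFieldTheory Literature.MathematicalPhysics.QuantumLattice
open Literature.Probability.LatticeModels
open scoped InnerProductSpace

namespace Summit.QuantumFields.QCD.Cruxes.RobustYangMillsHandover.PinTheInfimum

/-- **W3 (M1(b)): graded trace of powers of a Hermitian bounded-kernel operator as a periodic path integral.**
For a bounded, strongly measurable, Hermitian kernel `K : X → X → ℂ` on a finite measure space, any bounded
operator `A` on `L²(X, μ; ℂ)` given a.e. by the kernel, any countable Hilbert basis `b` of eigenvectors of `A`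
with real eigenvalues `lam`, any bounded measurable `θ : X → ℂ` and every `M`,
`Σᵢ λᵢ^{M+2} ∫ conj bᵢ · θ · bᵢ dμ = ∫ θ(V 0) ∏_{t : Fin (M+2)} K(V t, V (t+1)) dμ^{⊗(M+2)}(V)`
(`Literature.Analysis.OperatorTheory.hasSum_pow_integral_cyclic_obs`; B. Simon, *Trace Ideals* (2005), Ch. 3;
Reed–Simon I §VI.6).  The statement is the registered stub signature verbatim. -/
theorem stub_gradedCyclicTrace :
    ∀ {X : Type*} [MeasurableSpace X] (μ : Measure X) [IsFiniteMeasure μ] (K : X → X → ℂ) (C : ℝ),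
      StronglyMeasurable (uncurry K) → (∀ x y, ‖K x y‖ ≤ C) → (∀ x y, K x y = (starRingEnd ℂ) (K y x)) →
      ∀ (A : Lp ℂ 2 μ →L[ℂ] Lp ℂ 2 μ),
        (∀ φ : Lp ℂ 2 μ, (A φ : X → ℂ) =ᵐ[μ] fun x => ∫ y, K x y * φ y ∂μ) →
        ∀ {ι : Type*} [Countable ι] (b : HilbertBasis ι ℂ (Lp ℂ 2 μ)) (lam : ι → ℝ),
          (∀ i, A (b i) = (lam i : ℂ) • (b i : Lp ℂ 2 μ)) →
          ∀ (θ : X → ℂ) (Cθ : ℝ), Measurable θ → (∀ x, ‖θ x‖ ≤ Cθ) →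
            ∀ M : ℕ, HasSum (fun i => (lam i : ℂ) ^ (M + 2) *
                ∫ x, (starRingEnd ℂ) ((b i : Lp ℂ 2 μ) x) * (θ x * (b i : Lp ℂ 2 μ) x) ∂μ)
              (∫ V : Fin (M + 2) → X, θ (V 0) * ∏ t, K (V t) (V (t + 1)) ∂(Measure.pi fun _ => μ)) := by
  intro X _ μ _ K C hK hC hherm A hA ι _ b lam hb θ Cθ hθ hθb M
  exact Literature.Analysis.OperatorTheory.hasSum_pow_integral_cyclic_obs μ K C hK hC hherm A hA b lam hb θ Cθ
    hθ hθb M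

end Summit.QuantumFields.QCD.Cruxes.RobustYangMillsHandover.PinTheInfimum
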